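import Mathlib.FieldTheory.PurelyInseparable.Tower
import Mathlib.RingTheory.AlgebraicIndependent.AlgebraicClosure
import Mathlib.FieldTheory.IntermediateField.Adjoin.Algebra
import Mathlib.RingTheory.Flat.Basic
import Mathlib.RingTheory.TensorProduct.Basic
import HarnessLib

/-!
# Linear disjointness of a purely inseparable extension from a separably generated one

Topic: `Literature/AlgebraicGeometry/Resolution`. Auxiliary field theory for the "standard limit
argument" in Görtz–Wedhorn, *Algebraic Geometry II*, proof of Lemma 26.43 (1) (p. 706) — the
descent of the smooth normalization of a curve from the perfect closure `k^{perf}` of the ground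
field to a finite purely inseparable extension — as consumed by M. Temkin, *Inseparable local
uniformization*, J. Algebra 373 (2013), proof of Thm. 3.3.1, Step 1 (the named fact
`Temkin2013CurveSmoothing` of `InseparableLocalUniformizationCurvesStepOne.lean`). The descent
compares `k^{perf} ⊗_l A₀` with the compositum `k^{perf} · A₀` inside a big field `Ω`, and for this
one needs that `k^{perf}` and the function field `F = l(x)(y)` are **linearly disjoint** over `l`
once `F/l` is separably generated (Mac Lane's criterion, easy direction). Everything here is
classical and PROVED:

* `linearIndependent_adjoin_of_algebraicIndependent` — if `P/l` is algebraic and `x` is a family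
  of elements of `Ω ⊇ P` algebraically independent over `l`, then an `l`-linearly independent
  family in `P` stays linearly independent over the purely transcendental field `l(x)`
  (because `x` stays algebraically independent over `P`, Mathlib's
  `AlgebraicIndependent.extendScalars`).
* `linearDisjoint_of_isPurelyInseparable_of_isSeparable` — if `P/l` is purely inseparable and
  `𝔽 ⊇ l(x)` is an intermediate field of `Ω/l` all of whose elements are separable over `l(x)`,
  then `𝔽` and `P` are linearly disjoint over `l` (the algebraic layer is Mathlib's
  `LinearIndependent.map_of_isPurelyInseparable_of_isSeparable`).
* `injective_lift_mul_of_linearDisjoint`, `injective_tensorProductLift_of_linearDisjoint` — the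
  consequence actually used: for an `l`-module (resp. `l`-algebra) `V` embedded in `𝔽`, the
  multiplication map `P ⊗_l V → Ω` is injective.

## References

* U. Görtz, T. Wedhorn, *Algebraic Geometry II*, Springer (2023), proof of Lemma 26.43 (1), p. 706.
* N. Bourbaki, *Algèbre*, Ch. V, §15 (Mac Lane's criterion); folklore.
-/

noncomputable section

open IntermediateField TensorProduct

namespace Literature.AlgebraicGeometry.Resolution

universe u v w

variable {l : Type u} {Ω : Type v} [Field l] [Field Ω] [Algebra l Ω]
variable (P : Type w) [Field P] [Algebra l P] [Algebra P Ω] [IsScalarTower l P Ω]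

/-! ### The transcendental layer -/

open scoped IntermediateField.algebraAdjoinAdjoin in
/-- **Purely transcendental versus algebraic.** Let `P ⊇ l` be an algebraic extension inside
`Ω`, and `x` a family in `Ω` algebraically independent over `l`. Then every `l`-linearly
independent family `π` in `P` is linearly independent over the purely transcendental subfield
`l(x) ⊆ Ω`: clearing denominators, a relation `∑ fᵢ πᵢ = 0` with `fᵢ ∈ l[x]` is the vanishing at
`x` of the polynomial `∑ πᵢ Fᵢ ∈ P[X]`, which is zero because `x` stays algebraically independent
over `P` (`AlgebraicIndependent.extendScalars`); comparing coefficients gives `Fᵢ = 0`.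
[folklore] -/
theorem linearIndependent_adjoin_of_algebraicIndependent [Algebra.IsAlgebraic l P]
    {ι : Type*} {x : ι → Ω} (hx : AlgebraicIndependent l x)
    {κ : Type*} {π : κ → P} (hπ : LinearIndependent l π) :
    LinearIndependent (adjoin l (Set.range x)) (fun i => algebraMap P Ω (π i)) := by
  classical
  set R₀ : Subalgebra l Ω := Algebra.adjoin l (Set.range x) with hR₀
  set E₀ : IntermediateField l Ω := adjoin l (Set.range x) with hE₀
  have hxP : AlgebraicIndependent P x := hx.extendScalars P
  rw [linearIndependent_iff']
  intro T g hsum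
  -- clear denominators: `d • g i = f i ∈ l[x]`
  obtain ⟨d, hd⟩ := IsLocalization.exist_integer_multiples (nonZeroDivisors R₀) T g
  choose! f hf using hd
  -- polynomial representatives of the `f i`
  have hrep : ∀ i, ∃ F : MvPolynomial ι l, MvPolynomial.aeval x F = (f i : Ω) := fun i => by
    have hfi : (f i : Ω) ∈ Algebra.adjoin l (Set.range x) := (f i).2
    rw [Algebra.adjoin_range_eq_range_aeval] at hfi
    obtain ⟨F, hF⟩ := hfi
    exact ⟨F, hF⟩
  choose F hF using hrep
  -- the relation, multiplied by `d`, is the vanishing of a polynomial over `P` at `x`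
  have hcoe : ∀ i ∈ T, (f i : Ω) = ((d : R₀) : Ω) * (g i : Ω) := fun i hi => by
    have h1 := congrArg (fun z : E₀ => (z : Ω)) (hf i hi)
    simp only [Algebra.smul_def, IntermediateField.coe_mul] at h1
    exact h1
  set G : MvPolynomial ι P :=
    ∑ i ∈ T, MvPolynomial.C (π i) * MvPolynomial.map (algebraMap l P) (F i) with hG
  have hGx : MvPolynomial.aeval x G = 0 := by
    have hsum' : ∑ i ∈ T, (g i : Ω) * algebraMap P Ω (π i) = 0 := by
      simpa only [IntermediateField.smul_def, smul_eq_mul] using hsum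
    simp only [hG, map_sum, map_mul, MvPolynomial.aeval_C, MvPolynomial.aeval_map_algebraMap, hF]
    calc ∑ i ∈ T, algebraMap P Ω (π i) * (f i : Ω)
        = ∑ i ∈ T, ((d : R₀) : Ω) * ((g i : Ω) * algebraMap P Ω (π i)) := by
          refine Finset.sum_congr rfl fun i hi => ?_
          rw [hcoe i hi]; ring
      _ = 0 := by rw [← Finset.mul_sum, hsum', mul_zero]
  have hG0 : G = 0 := (injective_iff_map_eq_zero _).mp hxP G hGx
  -- compare coefficients
  have hcoeff : ∀ m, ∑ i ∈ T, (F i).coeff m • π i = 0 := fun m => by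
    have h1 := congrArg (MvPolynomial.coeff m) hG0
    simp only [hG, MvPolynomial.coeff_sum, MvPolynomial.coeff_C_mul, MvPolynomial.coeff_map,
      MvPolynomial.coeff_zero] at h1
    simpa only [Algebra.smul_def, mul_comm] using h1
  have hFi : ∀ i ∈ T, F i = 0 := fun i hi => by
    ext m
    rw [MvPolynomial.coeff_zero]
    exact (linearIndependent_iff'.mp hπ) T (fun j => (F j).coeff m) (hcoeff m) i hi
  intro i hi
  have hfi : (f i : Ω) = 0 := by rw [← hF i, hFi i hi, map_zero]
  have h1 : algebraMap R₀ E₀ d * g i = 0 := by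
    rw [← Algebra.smul_def, ← hf i hi]
    exact Subtype.ext (by simpa using hfi)
  have hd0 : algebraMap R₀ E₀ d ≠ 0 := IsFractionRing.to_map_ne_zero_of_mem_nonZeroDivisors d.2
  exact (mul_eq_zero.mp h1).resolve_left hd0

/-! ### Linear disjointness -/

/-- **A purely inseparable and a separably generated extension are linearly disjoint**
(Mac Lane's criterion, easy direction). Let `P/l` be purely inseparable, `x` a family in `Ω`
algebraically independent over `l`, and `𝔽 ⊇ l(x)` an intermediate field of `Ω/l` every
element of which is separable (algebraic) over `l(x)`. Then `𝔽` and `P` are linearly disjoint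
over `l`. Proof: an `l`-basis `πᵢ` of `P` is `𝔽`-linearly independent — expand the
coefficients of a relation in an `l(x)`-basis `wⱼ` of `𝔽`; the `wⱼ` stay linearly independent
over the purely inseparable extension `l(x)(P)` of `l(x)` (Mathlib's
`LinearIndependent.map_of_isPurelyInseparable_of_isSeparable`), and the `πᵢ` are
`l(x)`-linearly independent (`linearIndependent_adjoin_of_algebraicIndependent`). [folklore] -/
theorem linearDisjoint_of_isPurelyInseparable_of_isSeparable [IsPurelyInseparable l P]
    {ι : Type*} {x : ι → Ω} (hx : AlgebraicIndependent l x)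
    (𝔽 : IntermediateField l Ω) (hx𝔽 : ∀ i, x i ∈ 𝔽)
    (hsep : ∀ y ∈ 𝔽, IsSeparable (adjoin l (Set.range x)) y) : 𝔽.LinearDisjoint P := by
  classical
  set E₀ : IntermediateField l Ω := adjoin l (Set.range x) with hE₀
  haveI : ExpChar E₀ (ringExpChar l) :=
    expChar_of_injective_algebraMap (algebraMap l E₀).injective _
  have hE₀𝔽 : E₀ ≤ 𝔽 := adjoin_le_iff.mpr (by rintro _ ⟨i, rfl⟩; exact hx𝔽 i)
  let 𝔽' : IntermediateField E₀ Ω := extendScalars hE₀𝔽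
  have hmem𝔽' : ∀ y : Ω, y ∈ 𝔽' ↔ y ∈ 𝔽 := fun y => Iff.rfl
  -- `E = l(x)(P)` is purely inseparable over `E₀ = l(x)`
  set E : IntermediateField E₀ Ω := adjoin E₀ (Set.range (algebraMap P Ω)) with hE
  haveI hEpi : IsPurelyInseparable E₀ E := by
    rw [hE, isPurelyInseparable_adjoin_iff_pow_mem E₀ Ω (ringExpChar l)]
    rintro _ ⟨p, rfl⟩
    obtain ⟨n, c, hc⟩ := IsPurelyInseparable.pow_mem l (ringExpChar l) p
    refine ⟨n, algebraMap l E₀ c, ?_⟩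
    rw [← IsScalarTower.algebraMap_apply, IsScalarTower.algebraMap_apply l P Ω, hc, map_pow]
  -- bases
  obtain ⟨κ, ⟨b⟩⟩ := Module.Basis.exists_basis l P
  refine LinearDisjoint.of_basis_right' b ?_
  have hi : LinearIndependent E₀ (algebraMap P Ω ∘ ⇑b) :=
    linearIndependent_adjoin_of_algebraicIndependent P hx b.linearIndependent
  obtain ⟨J, ⟨w⟩⟩ := Module.Basis.exists_basis E₀ 𝔽'
  have hii : LinearIndependent E (fun j => ((w j : 𝔽') : Ω)) := by
    refine LinearIndependent.map_of_isPurelyInseparable_of_isSeparable E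
      (fun j => hsep _ ((hmem𝔽' _).mp (w j).2)) ?_
    exact w.linearIndependent.map' 𝔽'.val.toLinearMap
      (LinearMap.ker_eq_bot_of_injective 𝔽'.val.injective)
  rw [linearIndependent_iff']
  intro T g hsum
  -- coefficients of `g i` in the basis `w`
  let g' : κ → 𝔽' := fun i => ⟨(g i : Ω), (hmem𝔽' _).mpr (g i).2⟩
  set S : Finset J := T.biUnion fun i => (w.repr (g' i)).support with hS
  have hsupp : ∀ i ∈ T, (w.repr (g' i)).support ⊆ S := fun i hi =>
    Finset.subset_biUnion_of_mem (fun i => (w.repr (g' i)).support) hi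
  have hexp : ∀ i ∈ T, (g i : Ω) = ∑ j ∈ S, (w.repr (g' i) j : Ω) * ((w j : 𝔽') : Ω) := by
    intro i hi
    have h1 : (g' i : 𝔽') = ∑ j ∈ S, w.repr (g' i) j • w j := by
      conv_lhs => rw [← w.linearCombination_repr (g' i)]
      rw [Finsupp.linearCombination_apply,
        Finsupp.sum_of_support_subset _ (hsupp i hi) (fun j a => a • w j) (fun j _ => zero_smul _ _)]
    have h2 := congrArg (fun z : 𝔽' => (z : Ω)) h1
    rw [show ((g' i : 𝔽') : Ω) = (g i : Ω) from rfl] at h2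
    rw [h2, AddSubmonoidClass.coe_finsetSum]
    refine Finset.sum_congr rfl fun j _ => ?_
    rw [IntermediateField.coe_smul, IntermediateField.smul_def, smul_eq_mul]
  -- regroup the relation along `w`
  have hδmem : ∀ j, (∑ i ∈ T, (w.repr (g' i) j : Ω) * algebraMap P Ω (b i)) ∈ E := fun j => by
    refine sum_mem fun i _ => mul_mem ?_ ?_
    · exact E.algebraMap_mem _
    · exact subset_adjoin E₀ _ ⟨b i, rfl⟩
  have hsum' : ∑ j ∈ S, (⟨_, hδmem j⟩ : E) • ((w j : 𝔽') : Ω) = 0 := by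
    have h0 : ∑ i ∈ T, (g i : Ω) * algebraMap P Ω (b i) = 0 := by
      simpa only [IntermediateField.smul_def, smul_eq_mul, Function.comp_apply] using hsum
    calc ∑ j ∈ S, (⟨_, hδmem j⟩ : E) • ((w j : 𝔽') : Ω)
        = ∑ j ∈ S, (∑ i ∈ T, (w.repr (g' i) j : Ω) * algebraMap P Ω (b i)) *
            ((w j : 𝔽') : Ω) := by
          refine Finset.sum_congr rfl fun j _ => ?_
          rw [IntermediateField.smul_def, smul_eq_mul]
      _ = ∑ i ∈ T, (∑ j ∈ S, (w.repr (g' i) j : Ω) * ((w j : 𝔽') : Ω)) *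
            algebraMap P Ω (b i) := by
          simp_rw [Finset.sum_mul]
          rw [Finset.sum_comm]
          refine Finset.sum_congr rfl fun i _ => Finset.sum_congr rfl fun j _ => ?_
          ring
      _ = ∑ i ∈ T, (g i : Ω) * algebraMap P Ω (b i) := by
          refine Finset.sum_congr rfl fun i hi => ?_
          rw [← hexp i hi]
      _ = 0 := h0
  have hδ0 : ∀ j ∈ S, ∑ i ∈ T, (w.repr (g' i) j : Ω) * algebraMap P Ω (b i) = 0 := by
    intro j hj
    have := (linearIndependent_iff'.mp hii) S (fun j => ⟨_, hδmem j⟩) hsum' j hj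
    exact congrArg (fun z : E => (z : Ω)) this
  -- the `πᵢ` are `l(x)`-linearly independent: all coefficients vanish
  have hc0 : ∀ j ∈ S, ∀ i ∈ T, w.repr (g' i) j = 0 := by
    intro j hj
    refine (linearIndependent_iff'.mp hi) T (fun i => w.repr (g' i) j) ?_
    simpa only [IntermediateField.smul_def, smul_eq_mul, Function.comp_apply] using hδ0 j hj
  intro i hi
  have hrepr : w.repr (g' i) = 0 := by
    refine Finsupp.ext fun j => ?_
    by_cases hj : j ∈ S
    · exact hc0 j hj i hi
    · have : j ∉ (w.repr (g' i)).support := fun h => hj (hsupp i hi h)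
      simpa [Finsupp.mem_support_iff] using this
  have hg' : g' i = 0 := by simpa using hrepr
  have : (g i : Ω) = 0 := congrArg (fun z : 𝔽' => (z : Ω)) hg'
  exact Subtype.ext this

/-! ### Consequence: injectivity of the multiplication map `P ⊗_l V → Ω` -/

variable {P}

/-- If `𝔽` and `P` are linearly disjoint over `l`, then for every `l`-vector space `V` embedded
in `𝔽` the multiplication map `P ⊗_l V → Ω`, `p ⊗ v ↦ p · v`, is injective. [folklore] -/
theorem injective_lift_mul_of_linearDisjoint {𝔽 : IntermediateField l Ω} (H : 𝔽.LinearDisjoint P)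
    {V : Type*} [AddCommGroup V] [Module l V] (ι : V →ₗ[l] Ω) (hι : Function.Injective ι)
    (hV : ∀ v, ι v ∈ 𝔽) :
    Function.Injective (TensorProduct.lift
      ((LinearMap.mul l Ω).compl₁₂ (IsScalarTower.toAlgHom l P Ω).toLinearMap ι)) := by
  set Rg : Subalgebra l Ω := (IsScalarTower.toAlgHom l P Ω).range with hRg
  have hinj : Function.Injective (Submodule.mulMap (Subalgebra.toSubmodule 𝔽.toSubalgebra)
      (Subalgebra.toSubmodule Rg)) := H.injective
  let eP : P →ₗ[l] Subalgebra.toSubmodule Rg :=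
    (IsScalarTower.toAlgHom l P Ω).rangeRestrict.toLinearMap
  have heP : Function.Injective eP := fun a b h => by
    have := congrArg (fun z : Rg => (z : Ω)) h
    exact (IsScalarTower.toAlgHom l P Ω).injective this
  let ι' : V →ₗ[l] Subalgebra.toSubmodule 𝔽.toSubalgebra := ι.codRestrict _ hV
  have hι' : Function.Injective ι' := fun a b h => hι (congrArg Subtype.val h)
  have hmap : Function.Injective (TensorProduct.map ι' eP) := by
    rw [← LinearMap.rTensor_comp_lTensor]
    exact (Module.Flat.rTensor_preserves_injective_linearMap _ hι').comp
      (Module.Flat.lTensor_preserves_injective_linearMap _ heP)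
  have hcomp : TensorProduct.lift
      ((LinearMap.mul l Ω).compl₁₂ (IsScalarTower.toAlgHom l P Ω).toLinearMap ι) =
      (Submodule.mulMap (Subalgebra.toSubmodule 𝔽.toSubalgebra) (Subalgebra.toSubmodule Rg)) ∘ₗ
        (TensorProduct.map ι' eP) ∘ₗ (TensorProduct.comm l P V).toLinearMap := by
    refine TensorProduct.ext' fun p v => ?_
    simp only [TensorProduct.lift.tmul, LinearMap.compl₁₂_apply, LinearMap.mul_apply',
      AlgHom.toLinearMap_apply, IsScalarTower.coe_toAlgHom', LinearMap.coe_comp,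
      LinearEquiv.coe_coe, Function.comp_apply, TensorProduct.comm_tmul, TensorProduct.map_tmul,
      Submodule.mulMap_tmul]
    rw [mul_comm]
    rfl
  rw [hcomp]
  exact hinj.comp (hmap.comp (TensorProduct.comm l P V).injective)

/-- Algebra form of `injective_lift_mul_of_linearDisjoint`: for an `l`-algebra `A` embedded in
`𝔽` by `g`, the `P`-algebra map `P ⊗_l A → Ω`, `p ⊗ a ↦ p · g(a)`, is injective. [folklore] -/
theorem injective_tensorProductLift_of_linearDisjoint {𝔽 : IntermediateField l Ω}
    (H : 𝔽.LinearDisjoint P) {A : Type*} [CommRing A] [Algebra l A] (g : A →ₐ[l] Ω)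
    (hg : Function.Injective g) (hA : ∀ a, g a ∈ 𝔽) :
    Function.Injective (Algebra.TensorProduct.lift (Algebra.ofId P Ω) g
      (fun _ _ => Commute.all _ _)) := by
  have key := injective_lift_mul_of_linearDisjoint H g.toLinearMap hg hA
  intro z₁ z₂ h
  apply key
  have heq : ∀ z, TensorProduct.lift ((LinearMap.mul l Ω).compl₁₂
      (IsScalarTower.toAlgHom l P Ω).toLinearMap g.toLinearMap) z =
      Algebra.TensorProduct.lift (Algebra.ofId P Ω) g (fun _ _ => Commute.all _ _) z := by
    intro z
    induction z using TensorProduct.induction_on with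
    | zero => simp
    | tmul p a =>
      simp [Algebra.TensorProduct.lift_tmul, Algebra.ofId_apply]
    | add z w hz hw => rw [map_add, map_add, hz, hw]
  rw [heq, heq, h]

end Literature.AlgebraicGeometry.Resolution

end
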